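import Summits.SmoothPoincare4.SmoothPoincare4.Theses.SullivanDual
import Summits.SmoothPoincare4.SmoothPoincare4.Theorems.SullivanDualHyperbolicEndTaubesModelDefs
import Summits.SmoothPoincare4.SmoothPoincare4.Theorems.SullivanDualHyperbolicEndSPC4Case
import Summits.SmoothPoincare4.SmoothPoincare4.Theorems.SullivanDualHyperbolicEndHelperCirculationDeriv
import Summits.SmoothPoincare4.SmoothPoincare4.Theorems.SullivanDualHyperbolicEndHelperSqOneFormLeMulTame
import Summits.SmoothPoincare4.SmoothPoincare4.Theorems.SullivanDualHyperbolicEndHelperPrimitiveTwoPunctured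
import Literature.Geometry.Symplectic.JHolomorphicMap
import Literature.Geometry.Symplectic.ExactNoJSpheres
import Literature.Analysis.ODE.ConstCoeffL2Vanishing

/-!
# Route `SullivanDual`, crux `HyperbolicEnd` (stmt-SmoothPoincare4-7825), line `taubes-circle-pencil`:
# stub S2 `stub_noWitnessOffDefect` — PROVED

Stub S2 of the checked skeleton `Cruxes/HyperbolicEnd/Lines/taubes_circle_pencil.lean` (the line's
FIRST LEMMA, Σ-blind): on a punctured homotopy `4`-sphere `Σ ∖ p` with `J² = −1` smooth in tangent
coordinates and a smooth CLOSED `2`-form `sf` taming `J` at every point outside an open `N`, there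
is no non-constant `C^∞` entire `J`-curve `u : ℂ → Σ ∖ p` avoiding both the punctured `ε`-chart-ball
and `N`.  In the line it is the no-bubbling-off-`Z` input of the compactness step of S3.  This file
also lands the registered helper `helper_curl_eq_zero_of_sq_le_mul_curl` (the planar isoperimetric
lemma, flat and Mathlib-only given `SullivanDualHyperbolicEndHelperCirculationDeriv.lean`).

## Proof (energy / isoperimetric argument for an exact taming form; no Brody lemma)

1. `K = {x | ¬ InPuncturedChartBall p ε x} ∩ Nᶜ` is compact (`Σ` compact, the chart-ball clause
   open, `N` open: `Sketch.isCompact_setOf_not_inPuncturedChartBall`) and contains `u(ℂ)`; `sf`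
   tames `J` at every point of `K`.
2. TOPOLOGY: `H²_dR(Σ ∖ p) = 0`, so `sf = dλ` for a smooth `1`-form `λ`
   (`helper_exists_primitive_two_punctured`, file `…HelperPrimitiveTwoPunctured`: de Rham's
   theorem `deRhamComparisonIso` + `H²(Σ ∖ p; ℝ) = 0` from `H²(Σ; ℝ) = H²(S⁴; ℝ) = 0` and
   Mayer–Vietoris across the acyclic overlap `ℝ⁴ ∖ 0`).
3. COMPACTNESS: one constant `M` with `λ_x(v)² ≤ M · sf_x(v, J_x v)` for `x ∈ K`
   (`helper_sq_oneForm_le_mul_tame`, file `…HelperSqOneFormLeMulTame`: continuity in tangent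
   coordinates, positive minimum on unit spheres, `IsCompact.induction_on`).
4. PULL-BACK: `β = u^*λ` is a `C^∞` `1`-form `b₁ dx + b₂ dy` on `ℂ` (tree:
   `contDiff_pullback_of_contMDiff`), with `d(u^*λ) = u^*(dλ)` (`extDeriv_pullback_apply_eq`), so
   its curl is the energy density `∂ₓ b₂ - ∂_y b₁ = sf(u_x, u_y) = sf(u_x, J u_x) ≥ 0`, and by 3.
   (with `v = u_x` and `v = u_y = J u_x`, using `sf(Jv, J²v) = sf(v, Jv)`)
   `b₁² + b₂² ≤ 2M · (∂ₓ b₂ - ∂_y b₁)`.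
5. PLANE (`curl_eq_zero_of_sq_le_mul_curl`, this file): such a `β` has zero curl — the
   circulation `Φ(R) = ∮_{∂D_R} β` has `Φ' = R ∫ curl ≥ 0` (Stokes on discs,
   `helper_hasDerivAt_circulation`), Cauchy–Schwarz (`Literature.Analysis.ODE.sq_intervalIntegral_le`) gives `Φ² ≤ 2π·max(2M,1) · R Φ'`, which with
   `Φ(0) = 0` forces `Φ ≡ 0` (`eq_zero_of_sq_le_mul_deriv`), hence `∫ curl = 0` on every circle
   and `curl ≡ 0` (`intervalIntegral.integral_pos`, continuity at the origin).
6. So `sf(u_x, J u_x) = 0`, tameness gives `u_x = 0`, `J`-holomorphicity `du = 0`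
   (`mfderiv_eq_zero_of_apply_one_eq_zero`), and `u` is constant
   (`apply_eq_apply_zero_of_mfderiv_eq_zero`) — contradicting `u z ≠ u z'`.

This is the isoperimetric/Ahlfors argument `A(R)² ≤ C R A'(R)` excluding Brody curves in exact
tame almost complex manifolds in its most elementary form.  References: J. Duval, *Un théorème de
Green presque complexe*, Ann. Inst. Fourier 54 (2004); B. Kruglikov, M. Overholt, Differential
Geom. Appl. 11 (1999); D. McDuff, D. Salamon, *Introduction to Symplectic Topology*, 3rd ed.
(2017), §4.5.  No named facts are used; axioms `{propext, Classical.choice, Quot.sound}`.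
-/

-- the registered namespace `Summit.SmoothPoincare4.SmoothPoincare4.…` repeats a component (P = Sub)
set_option linter.dupNamespace false

noncomputable section

open scoped Manifold ContDiff Topology Real
open Set Filter MeasureTheory intervalIntegral
open Literature.Geometry.Kaehler Literature.Geometry.Symplectic Literature.Topology.FourManifolds

namespace Summit.SmoothPoincare4.SmoothPoincare4.Cruxes.HyperbolicEnd.TaubesCirclePencil

/-! ### The planar isoperimetric lemma -/

section Planar

variable {b₁ b₂ : ℂ → ℝ}


/-- Elementary inequality: `(c y - s x)² ≤ (c² + s²)(x² + y²)` with `c² + s² = 1`. [folklore] -/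
theorem sq_cos_mul_sub_sin_mul_le (θ x y : ℝ) :
    (Real.cos θ * y - Real.sin θ * x) ^ 2 ≤ x ^ 2 + y ^ 2 := by
  have hcs := Real.cos_sq_add_sin_sq θ
  nlinarith [sq_nonneg (Real.cos θ * x + Real.sin θ * y)]

/-- **A planar vector field whose squared length is dominated by its non-negative curl has zero
curl** (the isoperimetric step of the energy argument for `J`-holomorphic planes: with
`Φ(R) = ∮_{∂D_R} β` and `A'(R) = R ∫ curl`, Cauchy–Schwarz gives `Φ² ≤ 2πM · R Φ'`, and the ODE
lemma forces `Φ = 0`, hence `curl = 0` on every circle).  Here `β = b₁ dx + b₂ dy` with `b₁, b₂`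
of class `C¹`, `curl β = ∂ₓ b₂ - ∂_y b₁`. [folklore] -/
theorem curl_eq_zero_of_sq_le_mul_curl (hb₁ : ContDiff ℝ 1 b₁) (hb₂ : ContDiff ℝ 1 b₂) {M : ℝ}
    (hF : ∀ z : ℂ, 0 ≤ fderiv ℝ b₂ z 1 - fderiv ℝ b₁ z Complex.I)
    (hM : ∀ z : ℂ, b₁ z ^ 2 + b₂ z ^ 2 ≤ M * (fderiv ℝ b₂ z 1 - fderiv ℝ b₁ z Complex.I)) :
    ∀ z : ℂ, fderiv ℝ b₂ z 1 - fderiv ℝ b₁ z Complex.I = 0 := by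
  -- abbreviations
  set F : ℂ → ℝ := fun z => fderiv ℝ b₂ z 1 - fderiv ℝ b₁ z Complex.I with hFdef
  have hFc : Continuous F := by
    have hd1 : Continuous (fderiv ℝ b₁) := hb₁.continuous_fderiv one_ne_zero
    have hd2 : Continuous (fderiv ℝ b₂) := hb₂.continuous_fderiv one_ne_zero
    simp only [hFdef]
    fun_prop
  -- a positive domination constant
  set M' : ℝ := max M 1 with hM'
  have hM'pos : 0 < M' := lt_of_lt_of_le one_pos (le_max_right _ _)
  have hM'' : ∀ z, b₁ z ^ 2 + b₂ z ^ 2 ≤ M' * F z := fun z =>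
    (hM z).trans (mul_le_mul_of_nonneg_right (le_max_left _ _) (hF z))
  -- circulation and its derivative
  set Φ : ℝ → ℝ := fun R => ∫ θ in (-π)..π,
    R * (Real.cos θ * b₂ (circleMap 0 R θ) - Real.sin θ * b₁ (circleMap 0 R θ)) with hΦ
  set Φ' : ℝ → ℝ := fun R => R * ∫ θ in (-π)..π, F (circleMap 0 R θ) with hΦ'
  have hd : ∀ R, HasDerivAt Φ (Φ' R) R := fun R => hasDerivAt_circulation hb₁ hb₂ R
  have h0 : Φ 0 = 0 := by simp [hΦ]
  have hFγc : ∀ R, Continuous fun θ : ℝ => F (circleMap 0 R θ) := fun R =>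
    hFc.comp (continuous_circleMap 0 R)
  have hint_nonneg : ∀ R, 0 ≤ ∫ θ in (-π)..π, F (circleMap 0 R θ) := fun R =>
    intervalIntegral.integral_nonneg (by linarith [Real.pi_pos]) fun θ _ => hF _
  have hpos : ∀ R, 0 ≤ R → 0 ≤ Φ' R := fun R hR => mul_nonneg hR (hint_nonneg R)
  -- the isoperimetric inequality `Φ² ≤ (2π M') R Φ'`
  have hineq : ∀ R, 0 < R → Φ R ^ 2 ≤ (2 * π * M') * R * Φ' R := by
    intro R hR
    have hgc := continuous_circulationIntegrand hb₁ hb₂ R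
    have h1 := Literature.Analysis.ODE.sq_intervalIntegral_le hgc (show -π ≤ π by linarith [Real.pi_pos])
    have h2 : ∫ θ in (-π)..π,
        (R * (Real.cos θ * b₂ (circleMap 0 R θ) - Real.sin θ * b₁ (circleMap 0 R θ))) ^ 2 ≤
        ∫ θ in (-π)..π, R ^ 2 * M' * F (circleMap 0 R θ) := by
      refine intervalIntegral.integral_mono_on (by linarith [Real.pi_pos])
        ((hgc.pow 2).intervalIntegrable _ _) ((continuous_const.mul (hFγc R)).intervalIntegrable _ _)
        fun θ _ => ?_
      have e1 := sq_cos_mul_sub_sin_mul_le θ (b₁ (circleMap 0 R θ)) (b₂ (circleMap 0 R θ))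
      have e2 := hM'' (circleMap 0 R θ)
      rw [mul_pow]
      have hR2 : 0 ≤ R ^ 2 := sq_nonneg R
      nlinarith
    rw [intervalIntegral.integral_const_mul] at h2
    have e3 : (π - -π) = 2 * π := by ring
    rw [e3] at h1
    calc Φ R ^ 2 ≤ 2 * π * ∫ θ in (-π)..π,
          (R * (Real.cos θ * b₂ (circleMap 0 R θ) - Real.sin θ * b₁ (circleMap 0 R θ))) ^ 2 := h1
      _ ≤ 2 * π * (R ^ 2 * M' * ∫ θ in (-π)..π, F (circleMap 0 R θ)) := by
          gcongr
      _ = (2 * π * M') * R * Φ' R := by simp only [hΦ']; ring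
  -- hence `Φ = 0` on `[0, ∞)` and `Φ' = 0` on `(0, ∞)`
  have hΦ0 := eq_zero_of_sq_le_mul_deriv (by positivity) hd h0 hpos hineq
  have hΦ'0 : ∀ R, 0 < R → Φ' R = 0 := by
    intro R hR
    have hev : Φ =ᶠ[𝓝 R] fun _ => 0 := by
      filter_upwards [Ioi_mem_nhds hR] with R' hR'
      exact hΦ0 R' (le_of_lt hR')
    have h1 : HasDerivAt Φ 0 R := (hasDerivAt_const R (0 : ℝ)).congr_of_eventuallyEq hev
    exact (hd R).unique h1
  -- so `F = 0` on every circle of positive radius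
  have hcircle : ∀ R, 0 < R → ∀ θ ∈ Icc (-π) π, F (circleMap 0 R θ) = 0 := by
    intro R hR
    have hI : ∫ θ in (-π)..π, F (circleMap 0 R θ) = 0 := by
      have := hΦ'0 R hR
      simp only [hΦ'] at this
      rcases mul_eq_zero.1 this with h | h
      · exact absurd h hR.ne'
      · exact h
    by_contra hne
    push Not at hne
    obtain ⟨θ₀, hθ₀, hFθ₀⟩ := hne
    have hlt : 0 < F (circleMap 0 R θ₀) := lt_of_le_of_ne (hF _) (Ne.symm hFθ₀)
    have := intervalIntegral.integral_pos (by linarith [Real.pi_pos]) (hFγc R).continuousOn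
      (fun θ _ => hF _) ⟨θ₀, hθ₀, hlt⟩
    linarith
  -- conclusion off the origin
  have hF0 : ∀ z : ℂ, z ≠ 0 → F z = 0 := by
    intro z hz
    have hzR : 0 < ‖z‖ := norm_pos_iff.2 hz
    have hrep : circleMap 0 ‖z‖ (Complex.arg z) = z := by
      simp only [circleMap, zero_add]
      exact Complex.norm_mul_exp_arg_mul_I z
    have harg : Complex.arg z ∈ Icc (-π) π := Ioc_subset_Icc_self (Complex.arg_mem_Ioc z)
    have := hcircle ‖z‖ hzR (Complex.arg z) harg
    rwa [hrep] at this
  -- and at the origin by continuity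
  intro z
  by_cases hz : z = 0
  · subst hz
    by_contra hne
    have hlt : 0 < F 0 := lt_of_le_of_ne (hF 0) (Ne.symm hne)
    have hev : ∀ᶠ w in 𝓝 (0 : ℂ), (fun _ : ℂ => (0 : ℝ)) w < F w :=
      continuousAt_const.eventually_lt hFc.continuousAt hlt
    obtain ⟨δ, hδ, hball⟩ := Metric.eventually_nhds_iff.1 hev
    have hw : dist ((δ / 2 : ℝ) : ℂ) 0 < δ := by
      rw [dist_zero_right, Complex.norm_real, Real.norm_eq_abs, abs_of_pos (by linarith)]
      linarith
    have h1 := hball hw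
    have h2 := hF0 ((δ / 2 : ℝ) : ℂ) (by
      rw [Ne, Complex.ofReal_eq_zero]; linarith)
    simp only at h1
    linarith
  · exact hF0 z hz

-- registered signature, verbatim on one line (gate matches name + header textually)
/-- **A planar vector field whose squared length is dominated by its non-negative curl has zero
curl** (registered helper; `curl_eq_zero_of_sq_le_mul_curl`): for `C¹` functions `b₁ b₂ : ℂ → ℝ`
with `0 ≤ ∂ₓ b₂ - ∂_y b₁` and `b₁² + b₂² ≤ M (∂ₓ b₂ - ∂_y b₁)` everywhere, `∂ₓ b₂ - ∂_y b₁ = 0`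
everywhere. [folklore] -/
theorem helper_curl_eq_zero_of_sq_le_mul_curl : ∀ (b₁ b₂ : ℂ → ℝ) (M : ℝ), ContDiff ℝ 1 b₁ → ContDiff ℝ 1 b₂ → (∀ z : ℂ, 0 ≤ fderiv ℝ b₂ z 1 - fderiv ℝ b₁ z Complex.I) → (∀ z : ℂ, b₁ z ^ 2 + b₂ z ^ 2 ≤ M * (fderiv ℝ b₂ z 1 - fderiv ℝ b₁ z Complex.I)) → ∀ z : ℂ, fderiv ℝ b₂ z 1 - fderiv ℝ b₁ z Complex.I = 0 := by
  intro b₁ b₂ M hb₁ hb₂ hF hM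
  exact curl_eq_zero_of_sq_le_mul_curl hb₁ hb₂ (M := M) hF hM

end Planar

/-! ### The stub -/

/-- Antisymmetry consequence for a `2`-form and an endomorphism with `J² = -1`:
`α(J v, J (J v)) = α(v, J v)`. [folklore] -/
theorem twoForm_apply_J_JJ {E : Type*} [AddCommGroup E] [Module ℝ E] [TopologicalSpace E]
    (A : E [⋀^Fin 2]→L[ℝ] ℝ) (J : E →L[ℝ] E) (hJ : ∀ v, J (J v) = -v) (v : E) :
    A ![J v, J (J v)] = A ![v, J v] := by
  rw [hJ]
  have h1 : A ![J v, -v] = -A ![J v, v] := by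
    have e : ∀ z : E, Function.update ![J v, v] 1 z = ![J v, z] := by
      intro z; funext i; fin_cases i <;> simp
    have h := A.map_update_smul ![J v, v] 1 (-1 : ℝ) v
    rw [e, e, neg_one_smul, smul_eq_mul, neg_one_mul] at h
    exact h
  have h2 : A ![J v, v] = -A ![v, J v] := by
    have := A.map_swap ![v, J v] (i := 0) (j := 1) (by decide)
    have e : ![v, J v] ∘ Equiv.swap (0 : Fin 2) 1 = ![J v, v] := by
      funext i; fin_cases i <;> simp [Equiv.swap_apply_left, Equiv.swap_apply_right]
    rw [e] at this
    exact this
  rw [h1, h2, neg_neg]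

-- registered signature, verbatim (gate matches name + header textually)
/-- **Stub S2 — no witness off the defect (PROVED).**  If `J² = −1` on `Σ ∖ p`, `J` is smooth in
tangent coordinates, and a smooth CLOSED `2`-form `sf` tames `J` at every point outside an open
set `N`, then there is no non-constant `C^∞` `J`-holomorphic `u : ℂ → Σ ∖ p` avoiding both the
punctured `ε`-chart-ball and `N`.  Proof (the energy/isoperimetric argument for an EXACT taming
form; Duval 2004, Kruglikov–Overholt 1999, McDuff–Salamon 2017 §4.5): the image of `u` lies in
the compact core `K = {¬ InPuncturedChartBall p ε} ∩ Nᶜ`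
(`Sketch.isCompact_setOf_not_inPuncturedChartBall`); `H²_dR(Σ ∖ p) = 0` gives `sf = dλ` with `λ`
smooth (`helper_exists_primitive_two_punctured`: de Rham's theorem + `H²(Σ ∖ p; ℝ) = 0`); on `K`,
`λ_x(v)² ≤ M sf_x(v, J v)` (`helper_sq_oneForm_le_mul_tame`: uniform tameness, bounded primitive);
the pulled-back form `β = u^*λ = b₁ dx + b₂ dy` on `ℂ` then has curl
`∂ₓ b₂ - ∂_y b₁ = sf(u_x, J u_x) ≥ 0` dominating `b₁² + b₂²`, so the planar isoperimetric lemma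
(`helper_curl_eq_zero_of_sq_le_mul_curl`: `A² ≤ C R A'` forces `A = 0`) kills the energy
density; hence `u_x = 0`, `du = 0`, and `u` is constant — contradiction.  No Brody
reparametrisation is needed. [cite: McDuffSalamon2017, §4.5 eq. (4.5.4)] -/
theorem stub_noWitnessOffDefect :
    ∀ (S : HomotopySphere 4) (p : S.carrier)
      (J : ∀ x : ↥(punctured p), TangentSpace (𝓡 4) x →L[ℝ] TangentSpace (𝓡 4) x)
      (sf : MForm (𝓡 4) ↥(punctured p) ℝ 2) (N : Set ↥(punctured p)) (ε : ℝ), 0 < ε → IsOpen N →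
      (∀ (x : ↥(punctured p)) (v : TangentSpace (𝓡 4) x), J x (J x v) = -v) →
      (∀ x₀ : ↥(punctured p), ContMDiffAt (𝓡 4) 𝓘(ℝ, EuclideanSpace ℝ (Fin 4) →L[ℝ] EuclideanSpace ℝ (Fin 4)) ∞
        (inTangentCoordinates (𝓡 4) (𝓡 4) (id : ↥(punctured p) → ↥(punctured p)) id (fun x => J x) x₀) x₀) →
      IsSmoothForm sf → IsClosedForm sf →
      (∀ x : ↥(punctured p), x ∉ N → ∀ v : TangentSpace (𝓡 4) x, v ≠ 0 → 0 < sf x ![v, J x v]) →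
      ¬ ∃ u : ℂ → ↥(punctured p),
        (ContMDiff 𝓘(ℝ, ℂ) (𝓡 4) ∞ u ∧ (∃ z z' : ℂ, u z ≠ u z') ∧
          (∀ z ζ : ℂ, mfderiv 𝓘(ℝ, ℂ) (𝓡 4) u z (Complex.I * ζ : ℂ) =
            J (u z) (mfderiv 𝓘(ℝ, ℂ) (𝓡 4) u z (ζ : ℂ))) ∧
          (∀ z : ℂ, ¬ InPuncturedChartBall p ε (u z)) ∧ (∀ z : ℂ, u z ∉ N)) := by
  intro S p J sf N ε hε hN hJ2 hJs hsf hsfc htame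
  rintro ⟨u, hu, ⟨z₁, z₂, hne⟩, hJhol, havoid, hNu⟩
  -- (E): a smooth primitive `λ` of `sf` on `Σ ∖ p`
  obtain ⟨lam, hlam, hdlam⟩ := helper_exists_primitive_two_punctured S p sf hsf hsfc
  -- the compact core `K = (Σ ∖ p) ∖ (B_ε ∪ N)` contains the image of `u`
  set K : Set ↥(punctured p) := {x | ¬ InPuncturedChartBall p ε x} ∩ Nᶜ with hKdef
  have hK : IsCompact K :=
    (Summit.SmoothPoincare4.SmoothPoincare4.Cruxes.HyperbolicEnd.Sketch.isCompact_setOf_not_inPuncturedChartBall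
      p hε).inter_right hN.isClosed_compl
  have huK : ∀ z, u z ∈ K := fun z => ⟨havoid z, hNu z⟩
  have hposK : ∀ x ∈ K, ∀ v : TangentSpace (𝓡 4) x, v ≠ 0 → 0 < sf x ![v, J x v] :=
    fun x hx v hv => htame x hx.2 v hv
  have hnonnegK : ∀ x ∈ K, ∀ v : TangentSpace (𝓡 4) x, 0 ≤ sf x ![v, J x v] := by
    intro x hx v
    by_cases hv : v = 0
    · rw [hv, map_zero]
      exact le_of_eq ((sf x).map_coord_zero (0 : Fin 2) rfl).symm
    · exact (hposK x hx v hv).le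
  -- (U): uniform domination `λ_x(v)² ≤ M sf_x(v, J v)` on `K`
  obtain ⟨M, hM0, hM⟩ := helper_sq_oneForm_le_mul_tame K lam sf J hK hlam hsf hJs hposK
  -- the pulled back `1`-form `β = u^*λ = b₁ dx + b₂ dy` on `ℂ`
  set β : ℂ → ℂ [⋀^Fin 1]→L[ℝ] ℝ := lam.pullback 𝓘(ℝ, ℂ) u with hβdef
  have hβ : ContDiff ℝ ∞ β := contDiff_pullback_of_contMDiff hlam hu
  have hβd : ∀ z, DifferentiableAt ℝ β z := fun z => (hβ.differentiable (by simp)) z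
  set b₁ : ℂ → ℝ := fun z => β z ![1] with hb₁def
  set b₂ : ℂ → ℝ := fun z => β z ![Complex.I] with hb₂def
  have hb₁ : ContDiff ℝ 1 b₁ :=
    ((ContinuousAlternatingMap.apply ℝ ℂ ℝ ![(1 : ℂ)]).contDiff.comp hβ).of_le (by exact_mod_cast le_top)
  have hb₂ : ContDiff ℝ 1 b₂ :=
    ((ContinuousAlternatingMap.apply ℝ ℂ ℝ ![Complex.I]).contDiff.comp hβ).of_le (by exact_mod_cast le_top)
  -- notation for `du`
  have hI : ∀ z, mfderiv 𝓘(ℝ, ℂ) (𝓡 4) u z Complex.I = J (u z) (mfderiv 𝓘(ℝ, ℂ) (𝓡 4) u z (1 : ℂ)) := by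
    intro z
    simpa using hJhol z 1
  -- the coefficients and the curl, intrinsically
  have hb₁eq : ∀ z, b₁ z = lam (u z) ![mfderiv 𝓘(ℝ, ℂ) (𝓡 4) u z (1 : ℂ)] := by
    intro z
    show β z ![1] = _
    have e1 : β z ![1] = lam (u z) (fun i => mfderiv 𝓘(ℝ, ℂ) (𝓡 4) u z (![(1 : ℂ)] i)) := rfl
    rw [e1]
    congr 1
    funext i
    fin_cases i
    rfl
  have hb₂eq : ∀ z, b₂ z = lam (u z) ![mfderiv 𝓘(ℝ, ℂ) (𝓡 4) u z Complex.I] := by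
    intro z
    show β z ![Complex.I] = _
    have e1 : β z ![Complex.I] = lam (u z) (fun i => mfderiv 𝓘(ℝ, ℂ) (𝓡 4) u z (![Complex.I] i)) := rfl
    rw [e1]
    congr 1
    funext i
    fin_cases i
    rfl
  have hcurl : ∀ z, fderiv ℝ b₂ z 1 - fderiv ℝ b₁ z Complex.I =
      sf (u z) ![mfderiv 𝓘(ℝ, ℂ) (𝓡 4) u z (1 : ℂ), J (u z) (mfderiv 𝓘(ℝ, ℂ) (𝓡 4) u z (1 : ℂ))] := by
    intro z
    have e1 : fderiv ℝ b₂ z 1 = fderiv ℝ β z 1 ![Complex.I] :=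
      fderiv_continuousAlternatingMap_apply_const_apply (hβd z) _ _
    have e2 : fderiv ℝ b₁ z Complex.I = fderiv ℝ β z Complex.I ![1] :=
      fderiv_continuousAlternatingMap_apply_const_apply (hβd z) _ _
    rw [e1, e2, ← extDeriv_apply_vec₂ (hβd z), hβdef, extDeriv_pullback_apply_eq hlam hu, hdlam]
    congr 1
    funext i
    fin_cases i <;> simp [hI]
  have hF : ∀ z, 0 ≤ fderiv ℝ b₂ z 1 - fderiv ℝ b₁ z Complex.I := fun z => by
    rw [hcurl z]
    exact hnonnegK (u z) (huK z) _
  have hdom : ∀ z, b₁ z ^ 2 + b₂ z ^ 2 ≤ (2 * M) * (fderiv ℝ b₂ z 1 - fderiv ℝ b₁ z Complex.I) := by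
    intro z
    rw [hcurl z, hb₁eq z, hb₂eq z, hI z]
    have h1 := hM (u z) (huK z) (mfderiv 𝓘(ℝ, ℂ) (𝓡 4) u z (1 : ℂ))
    have h2 := hM (u z) (huK z) (J (u z) (mfderiv 𝓘(ℝ, ℂ) (𝓡 4) u z (1 : ℂ)))
    rw [twoForm_apply_J_JJ (sf (u z)) (J (u z)) (hJ2 (u z))] at h2
    linarith
  -- the planar lemma: the energy density vanishes identically
  have hzero := helper_curl_eq_zero_of_sq_le_mul_curl b₁ b₂ (2 * M) hb₁ hb₂ hF hdom
  -- hence `du = 0` everywhere and `u` is constant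
  have hdu : ∀ z, mfderiv 𝓘(ℝ, ℂ) (𝓡 4) u z = 0 := by
    intro z
    refine mfderiv_eq_zero_of_apply_one_eq_zero (I := 𝓡 4) (J := J) (fun z ζ => hJhol z ζ) ?_
    by_contra he
    have hpos := hposK (u z) (huK z) _ he
    rw [← hcurl z, hzero z] at hpos
    exact lt_irrefl _ hpos
  have hconst := apply_eq_apply_zero_of_mfderiv_eq_zero (hu.of_le (by exact_mod_cast le_top)) hdu
  exact hne (by rw [hconst z₁, hconst z₂])

end Summit.SmoothPoincare4.SmoothPoincare4.Cruxes.HyperbolicEnd.TaubesCirclePencil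

end
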